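import Summits.ABC.IUTFork.ForkGenuineDepthZeroInflation
import Summits.ABC.IUTFork.ForkGenuineDepthPerImageSlotConstant
import Literature.IUT.LogVolume.TensorPacketSlotUnion
import Literature.IUT.LogVolume.LocalDegreeBridge
import HarnessLib

/-!
# The fork at [IUTchIII] Corollary 3.12 at a GENUINE input: RANK-ONE packets carry no indeterminacy, and over
# `F₀ = K = ℚ` the synthetic depth family has NO inflation at any prime (skeleton XXVIIe)

Record-only file (D-0012) of the abc-iut cell (deliverable (a), skeleton seat abc-iut-skel, gen 9); TAKES NO SIDE.
Sequel to `ForkGenuineDepthZeroInflation.lean` (XXVIId-b, p436438: at an UNRAMIFIED ODD prime the (Ind1)/(Ind2)/hull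
inflation of a Θ-idele of rational scalars vanishes, via [IUTchIV] Prop. 1.2 (iv)). Gen 8 recorded the fully numeric
threshold over `F₀ = K = ℚ` as BLOCKED on a `2`-adic log-shell lemma (`2` is always a support prime and Prop. 1.2 (iv)
needs `p > 2`). HERE that lemma is not needed: at a prime `p` where every genuine completion `K_{v̲}`, `v | p`, is a LINE
over `ℚ_p` (`[K_{v̲} : ℚ_p] = 1`) the packet algebra `⊗_b K_{v̲_b}` is ONE-dimensional, so

* `exists_eq_smul_of_finrank_eq_one` — every `ℚ_p`-linear automorphism of the packet, in particular every element of
  (Ind2) `= Aut_{ℚ_p}(V : log_p(R_I^×))`, is a scalar `u·id`;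
* **`indTwo_smul_smul_normalizedPacket_eq_of_finrank_eq_one`** — and `‖u‖ = 1` because (Ind2) preserves the log-volume
  ("the measure of sets are preserved", Dupuy–Hilado §4.9; `packetLogμ_indTwo_smul`) while `p^n` rescales it by `−n·log p`
  (`packetLogμ_ppow_smul`): hence `g·(c·(R_I)^∼) = c·(R_I)^∼` for EVERY `g ∈` (Ind2), every scalar `c`, EVERY prime `p`
  (`p = 2` included; no hypothesis on `log_p(R_I^×)` at all);
* **`realPrimePacketWith_negLogThetaAt_eq_of_scalar_of_finrank_eq_one`** — the rank-one twin of XXVIId-b's zero-inflation law: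
  a Θ-idele of rational scalars `t_{i,v} = p^{n_i}` at such a prime has `−|log(Θ)|_p = (1/ℓ⋇)·Σ_i (−n_i·log p)` EXACTLY;
* over `F₀ = K = ℚ` (`localDeg_rat_eq_one`: every local degree is `1`, by `Σ_{v|p} n_v = [ℚ:ℚ]`), along abc-iut-w5-d157's
  synthetic family: **`negLogThetaNonarch_deepAt_rat`** `= −((l+1)l/12)·N·log p` at EVERY prime `p` (the summand at every
  other support prime is `0`: unit ideles, `negLogThetaLoc_deepAt_rat_of_ne`), so **`cor312Of_deepAt_rat_iff`**:
  `Cor312Of (deepAt p l N σ) ↔ ((l+1)l/12 − 1)·N·log p ≤ ((l+5)/4)·log π` — the free gap against the archimedean term ALONE,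
  no intercept; the same in reading (P) (`cor312PerImageOf_deepAt_rat_iff`, via XXVIId-e). The resulting finite CENSUS
  (`(l,p,N) ∈ {(5,2,1),(5,2,2),(5,3,1),(5,5,1),(7,2,1)}`) is the companion file `ForkGenuineDepthRatCensus.lean` (XXVIIe-b).

READING (grammar of `HOME/skel/FORK-REAL-MODEL.md` §4/§10, `FORK-INDEX.md` row 2; no side taken): the first column of the
row-2 table in which EVERY quantity is a closed number — no ramification, no inflation at any prime, the archimedean term
`((l+5)/4)·log π` the only budget. HONEST SCOPE: synthetic inhabitants of abc-iut-S2's INPUT TYPE over `ℚ/ℚ` (genuine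
completions `ℚ_p`, synthetic ideles), NOT initial Θ-data of [IUTchI] Def. 3.1 — there `√−1 ∈ F ⊆ K = F(E_F[l])` (Def. 3.1 (a)),
so `K` is never `ℚ`; sharp (Ind3), full (Ind1)/(Ind2), Mochizuki's container. Nothing here bears on whether [IUTchIII] Thm. 3.11 licenses Cor. 3.12; typed ≠ proved. PROOF-ONLY file: no
definitions, no `Prop` facts.
[cite: Mochizuki2012, IUTchIV Prop. 1.2 p. 10, Thm. 1.10 Step (vi) p. 29, Step (vii) p. 30] [cite: DupuyHilado2025, §1 (1.1),
Def. 3.6.3, §3.9, §4.7, §4.9, §4.11–4.12] [cite: Mochizuki2012, IUTchIII Cor. 3.12 p. 173–174] [claim: Mochizuki2012, status: disputed]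
-/

noncomputable section

open Set Module Literature.IUT.LogVolume Literature.NumberTheory.NumberFields NumberField IsDedekindDomain
open scoped Pointwise

namespace Summit.ABC.IUTFork.GenuineContent

/-! ## §1 Packet algebra: a RANK-ONE packet — every (Ind2) element is a unit scalar -/

section RankOne

variable (p : ℕ) [Fact p.Prime] {ι : Type} [Fintype ι] [DecidableEq ι] [Nonempty ι]
variable (k : ι → Type) [∀ i, NontriviallyNormedField (k i)] [∀ i, NormedAlgebra ℚ_[p] (k i)]
  [∀ i, IsUltrametricDist (k i)] [∀ i, ProperSpace (k i)]

omit [DecidableEq ι] [Nonempty ι] [∀ i, IsUltrametricDist (k i)] [∀ i, ProperSpace (k i)] in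
/-- **A packet of lines is a line**: if every `k_i` is one-dimensional over `ℚ_p`, so is `V = ⊗_{ℚ_p} k_i` (tensor basis
indexed by `Π_i Fin 1`). [cite: DupuyHilado2025, Def. 3.6.1] -/
theorem finrank_packetAlgebra_eq_one (h1 : ∀ i, finrank ℚ_[p] (k i) = 1) :
    finrank ℚ_[p] (PacketAlgebra p k) = 1 := by
  haveI : ∀ i, Module.Finite ℚ_[p] (k i) := fun i =>
    Module.finite_of_finrank_pos (by rw [h1 i]; exact Nat.one_pos)
  let b : ∀ i, Basis (Fin 1) ℚ_[p] (k i) := fun i => Module.finBasisOfFinrankEq ℚ_[p] (k i) (h1 i)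
  rw [finrank_eq_card_basis (Basis.piTensorProduct b)]
  simp

omit [DecidableEq ι] [Nonempty ι] [∀ i, IsUltrametricDist (k i)] [∀ i, ProperSpace (k i)] in
/-- **On a rank-one packet every linear automorphism is a scalar**: `φ = u·id` with `u ∈ ℚ_p^×` (`V = ℚ_p·1`).
[cite: DupuyHilado2025, §4.9] -/
theorem exists_eq_smul_of_finrank_eq_one (h1 : ∀ i, finrank ℚ_[p] (k i) = 1)
    (φ : PacketAlgebra p k ≃ₗ[ℚ_[p]] PacketAlgebra p k) :
    ∃ u : ℚ_[p], u ≠ 0 ∧ ∀ x, φ x = u • x := by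
  haveI := nontrivial_packetAlgebra' p k
  have hV := (finrank_eq_one_iff_of_nonzero' (1 : PacketAlgebra p k) one_ne_zero).mp
    (finrank_packetAlgebra_eq_one p k h1)
  obtain ⟨u, hu⟩ := hV (φ 1)
  refine ⟨u, ?_, fun x => ?_⟩
  · rintro rfl
    rw [zero_smul] at hu
    exact one_ne_zero ((map_eq_zero_iff φ φ.injective).mp hu.symm)
  · obtain ⟨c, rfl⟩ := hV x
    rw [map_smul, ← hu, smul_smul, smul_smul, mul_comm]

omit [DecidableEq ι] [Nonempty ι] [∀ i, IsUltrametricDist (k i)] [∀ i, ProperSpace (k i)] in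
/-- (Ind2) on a rank-one packet acts on regions by one scalar: `g·A = u·A` for all `A`. [cite: DupuyHilado2025, §4.9] -/
theorem exists_indTwo_smul_set_eq_smul_of_finrank_eq_one (h1 : ∀ i, finrank ℚ_[p] (k i) = 1) (g : indTwo p k) :
    ∃ u : ℚ_[p], u ≠ 0 ∧ ∀ A : Set (PacketAlgebra p k), g • A = u • A := by
  obtain ⟨u, hu0, hu⟩ := exists_eq_smul_of_finrank_eq_one p k h1
    (g : PacketAlgebra p k ≃ₗ[ℚ_[p]] PacketAlgebra p k)
  refine ⟨u, hu0, fun A => ?_⟩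
  rw [indTwo_smul_set]
  ext y
  simp only [Set.mem_image, Set.mem_smul_set, hu]

/-- **(Ind2) FIXES every scalar multiple of `(R_I)^∼` on a rank-one packet**, at EVERY prime `p` (`p = 2` included, no
hypothesis on `log_p(R_I^×)`): an element `g` of (Ind2) is `u·id`; writing `u = p^n·w` with `‖w‖ = 1`, `w·(R_I)^∼ = (R_I)^∼`
(a unit does not move the integral structure) and `g·(R_I)^∼ = p^n·(R_I)^∼` has log-volume `−n·log p`; but (Ind2) preserves
log-volumes (Dupuy–Hilado §4.9 "the measure of sets are preserved"), so `n = 0` and `g·(c·(R_I)^∼) = c·(R_I)^∼`.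
[cite: DupuyHilado2025, §4.9] [cite: Mochizuki2012, IUTchIV Thm. 1.10 Step (vi) p. 29] -/
theorem indTwo_smul_smul_normalizedPacket_eq_of_finrank_eq_one (h1 : ∀ i, finrank ℚ_[p] (k i) = 1)
    (g : indTwo p k) (c : ℚ_[p]) :
    g • (c • (normalizedPacket p k : Set (PacketAlgebra p k))) =
      c • (normalizedPacket p k : Set (PacketAlgebra p k)) := by
  obtain ⟨u, hu0, hu⟩ := exists_indTwo_smul_set_eq_smul_of_finrank_eq_one p k h1 g
  have hp0 : (p : ℚ_[p]) ≠ 0 := Nat.cast_ne_zero.mpr (Fact.out : p.Prime).ne_zero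
  have hp0' : (p : ℝ) ≠ 0 := Nat.cast_ne_zero.mpr (Fact.out : p.Prime).ne_zero
  -- `u = p^n · w` with `‖w‖ = 1`
  obtain ⟨n, hn⟩ : ∃ n : ℤ, ‖u‖ = (p : ℝ) ^ (-n) := ⟨u.valuation, Padic.norm_eq_zpow_neg_valuation hu0⟩
  obtain ⟨w, hw_def⟩ : ∃ w : ℚ_[p], w = u * (p : ℚ_[p]) ^ (-n) := ⟨_, rfl⟩
  have hw : ‖w‖ = 1 := by
    rw [hw_def, norm_mul, norm_zpow, Padic.norm_p, hn, inv_zpow', neg_neg, ← zpow_add₀ hp0',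
      neg_add_cancel, zpow_zero]
  have huw : u = (p : ℚ_[p]) ^ n * w := by
    rw [hw_def, mul_left_comm, ← zpow_add₀ hp0, add_neg_cancel, zpow_zero, mul_one]
  -- a unit does not move `(R_I)^∼`
  have hwO : w • (normalizedPacket p k : Set (PacketAlgebra p k)) = normalizedPacket p k := by
    obtain ⟨i⟩ := ‹Nonempty ι›
    rw [smul_set_eq_algebraMap_smul, ← (iota p k i).commutes w]
    exact iota_smul_normalizedPacket_eq_of_norm_eq_one p k i (by rw [norm_algebraMap', hw])
  -- hence `g·(R_I)^∼ = p^n·(R_I)^∼`, and the preserved log-volume forces `n = 0`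
  have hgO : g • (normalizedPacket p k : Set (PacketAlgebra p k)) =
      ppow p k n • (normalizedPacket p k : Set (PacketAlgebra p k)) := by
    rw [hu, huw, ← smul_smul, hwO, ppow_smul_set_eq]
  have hvol := packetLogμ_indTwo_smul p k g (normalizedPacket p k : Set (PacketAlgebra p k))
  rw [hgO, packetLogμ_ppow_smul p k n (packetAdm_normalizedPacket p k), packetLogμ_normalizedPacket,
    add_zero, neg_eq_zero, mul_eq_zero] at hvol
  have hlogp : Real.log p ≠ 0 :=
    Real.log_ne_zero_of_pos_of_ne_one (by exact_mod_cast (Fact.out : p.Prime).pos)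
      (by exact_mod_cast (Fact.out : p.Prime).one_lt.ne')
  have hn0 : n = 0 := by exact_mod_cast hvol.resolve_right hlogp
  rw [hu, huw, hn0, zpow_zero, one_mul, smul_smul, mul_comm, ← smul_smul, hwO]

/-- **The (Ind2)-orbit of `c·(R_I)^∼` on a rank-one packet is `c·(R_I)^∼`** — the rank-one twin of XXVIId-b's
`iUnion_indTwo_smul_smul_normalizedPacket_eq` (there: `p > 2`, all `e_i = 1`, `|I| ≥ 2`, via [IUTchIV] Prop. 1.2 (iv); here:
all `[k_i : ℚ_p] = 1`, ANY `p`). [cite: DupuyHilado2025, §4.9, §4.11] [cite: Mochizuki2012, IUTchIV Thm. 1.10 Step (vi) p. 29] -/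
theorem iUnion_indTwo_smul_smul_normalizedPacket_eq_of_finrank_eq_one (h1 : ∀ i, finrank ℚ_[p] (k i) = 1)
    (c : ℚ_[p]) :
    (⋃ g : indTwo p k, g • (c • (normalizedPacket p k : Set (PacketAlgebra p k)))) =
      c • (normalizedPacket p k : Set (PacketAlgebra p k)) :=
  le_antisymm (Set.iUnion_subset fun g => (indTwo_smul_smul_normalizedPacket_eq_of_finrank_eq_one p k h1 g c).le)
    fun x hx => Set.mem_iUnion.mpr ⟨1, by rwa [one_smul]⟩

end RankOne

/-! ## §2 A Θ-idele of rational scalars at a prime of rank-one completions: `−|log(Θ)|_p` exactly -/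

section Scalar

variable {F : Type} [Field F] [NumberField F]
variable (p : ℕ) [hp : Fact p.Prime] (𝔽 : LocalFields F p)
variable (c : (j : ℕ) → (Fin (j + 1) → placesOver F p) → ℚ_[p]) (hc0 : ∀ j e, c j e ≠ 0)
  (hcσ : ∀ (j : ℕ) (σ : Equiv.Perm (Fin (j + 1))) (e : Fin (j + 1) → placesOver F p), c j (e ∘ σ) = c j e)

/-- **ZERO INFLATION for a Θ-idele of rational scalars at a prime of RANK-ONE completions** (real packet, ANY shell scalar `c`,
ANY prime `p`, `p = 2` included): if every `K_v` (`v | p`) is one-dimensional over `ℚ_p` and `t_{i,v} = p^{n_i}` for all `v | p`, then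
`−|log(Θ)|_p = (1/ℓ⋇)·Σ_i (−n_i·log p)` — at every summand the possible images of `p^{n_i}·(R_{v⃗})^∼` under (Ind1)/(Ind2) are
`p^{n_i}·(R_{v⃗})^∼`, its own hull, of log-volume `−n_i·log p`, and `Σ_{v⃗} Π Pr(v_b) = 1`. (Proof of XXVIId-b's
`realPrimePacketWith_negLogThetaAt_eq_of_scalar` with §1 in place of [IUTchIV] Prop. 1.2 (iv).)
[cite: Mochizuki2012, IUTchIV Thm. 1.10 Step (vi) p. 29] [cite: DupuyHilado2025, Def. 3.6.3, §4.11–4.12] [claim: Mochizuki2012, status: disputed] -/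
theorem realPrimePacketWith_negLogThetaAt_eq_of_scalar_of_finrank_eq_one
    (h1 : ∀ v : placesOver F p, finrank ℚ_[p] (𝔽.k v) = 1) {lstar : ℕ}
    (t : Fin lstar → (v : placesOver F p) → (𝔽.k v)ˣ) (n : Fin lstar → ℕ)
    (ht : ∀ (i : Fin lstar) (v : placesOver F p), (t i v : 𝔽.k v) = algebraMap ℚ_[p] (𝔽.k v) ((p : ℚ_[p]) ^ n i)) :
    (realPrimePacketWith p 𝔽 c hc0 hcσ).negLogThetaAt lstar t =
      (1 / (lstar : ℝ)) * ∑ i : Fin lstar, -((n i : ℝ) * Real.log p) := by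
  classical
  have hsum : ∑ v : placesOver F p, weight F v.1 = 1 := (localWeights F p).sum_pr
  have hW : ∀ m : ℕ, ∑ e : Fin m → placesOver F p, ∏ b, weight F (e b).1 = 1 := by
    intro m
    have h := Finset.prod_univ_sum (t := fun _ : Fin m => (Finset.univ : Finset (placesOver F p)))
      (f := fun _ v => weight F v.1)
    rw [Fintype.piFinset_univ] at h
    rw [← h, hsum, Finset.prod_const_one]
  -- per summand: hull of the possible images = `p^{n_i}·(R_{v⃗})^∼`, log-volume `−n_i·log p`
  have hval : ∀ (i : Fin lstar) (e : Fin ((i : ℕ) + 1 + 1) → placesOver F p),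
      (realPrimePacketWith p 𝔽 c hc0 hcσ).logμ ((realPrimePacketWith p 𝔽 c hc0 hcσ).possibleImagesHull
        ((realPrimePacketWith p 𝔽 c hc0 hcσ).pilotRegion t) ((i : ℕ) + 1) e) = -((n i : ℝ) * Real.log p) := by
    intro i e
    change packetLogμ p (fun b => 𝔽.k (e b)) (packetHull p (fun b => 𝔽.k (e b))
      ((realPrimePacketWith p 𝔽 c hc0 hcσ).possibleImages
        ((realPrimePacketWith p 𝔽 c hc0 hcσ).pilotRegion t) ((i : ℕ) + 1) e)) = _
    rw [realPrimePacketWith_possibleImages_pilotRegion_eq p 𝔽 c hc0 hcσ t i e,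
      iUnion_iota_smul_eq_smul_of_eq_algebraMap p (fun b => 𝔽.k (e b)) ((p : ℚ_[p]) ^ n i) _
        (fun a => ht i (e a)) _,
      iUnion_indTwo_smul_smul_normalizedPacket_eq_of_finrank_eq_one p (fun b => 𝔽.k (e b)) (fun b => h1 (e b)) _,
      ← zpow_natCast, ← ppow_smul_set_eq, packetHull_smul_normalizedPacket,
      packetLogμ_ppow_smul p _ _ (packetAdm_normalizedPacket p _), packetLogμ_normalizedPacket, add_zero]
    push_cast
    ring
  unfold PrimePacket.negLogThetaAt PrimePacket.lnνLp PrimePacket.lnνTensorPower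
  refine congrArg (fun x : ℝ => (1 / (lstar : ℝ)) * x) (Finset.sum_congr rfl fun i _ => ?_)
  rw [Finset.sum_congr rfl fun e _ => by rw [hval i e], ← Finset.mul_sum, hW, mul_one]

end Scalar

/-! ## §3 Over `F₀ = K = ℚ`: every completion is a line, the family's `−|log(Θ)|` has NO inflation at any prime -/

section OverQ

/-- Every finite place of `ℚ` has local degree `n_v = e_v·f_v = 1` (`Σ_{v|p} n_v = [ℚ:ℚ] = 1`, every `n_v ≥ 1`).
[cite: NeukirchANT1999, Ch. II Prop. (8.5)] -/
theorem localDeg_rat_eq_one (w : HeightOneSpectrum (𝓞 ℚ)) : localDeg ℚ w = 1 := by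
  haveI : Fact (residueChar ℚ w).Prime := ⟨residueChar_prime ℚ w⟩
  have hw : w ∈ placesOver ℚ (residueChar ℚ w) := (mem_placesOver_iff_residueChar w).mpr rfl
  have hsum := sum_localDeg ℚ (residueChar ℚ w)
  rw [Module.finrank_self] at hsum
  have hle : localDeg ℚ w ≤ ∑ v ∈ placesOver ℚ (residueChar ℚ w), localDeg ℚ v :=
    Finset.single_le_sum (fun v _ => Nat.zero_le _) hw
  have hpos := localDeg_pos ℚ w
  omega

/-- For any section `σ` of the places of `ℚ` over those of `ℚ`, the genuine completion `ℚ_{v̲}` at a place over `p` is ONE-dimensional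
over `ℚ_p`. [cite: NeukirchANT1999, Ch. II Prop. (8.5)] -/
theorem finrank_localFields_rat_eq_one (σ : PlaceSection ℚ ℚ) (p : ℕ) [Fact p.Prime] (v : placesOver ℚ p) :
    finrank ℚ_[p] ((σ.localFields p).k v) = 1 := by
  rw [PlaceSection.finrank_localFields_k]
  exact localDeg_rat_eq_one _

variable (p : ℕ) [hp : Fact p.Prime] (l : ℕ) (hl : l.Prime) (h5 : 5 ≤ l) (σ : PlaceSection ℚ ℚ)

/-- **Over `ℚ/ℚ` the deep prime's summand is the BARE value at EVERY prime `p`** (`p = 2` and `p` "ramified" are no exceptions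
here: there is no ramification and the packets are lines): `negLogThetaLoc (deepAt p l N σ) p = −((l+1)l/12)·N·log p`.
[cite: Mochizuki2012, IUTchIV Thm. 1.10 Step (vi) p. 29] [cite: DupuyHilado2025, §1 (1.1), Def. 3.6.3] [claim: Mochizuki2012, status: disputed] -/
theorem negLogThetaLoc_deepAt_rat_self (N : ℕ) (hN : 0 < N) :
    (ThetaVolumeInput.deepAt p l hl h5 N hN σ).negLogThetaLoc p = -(((l : ℝ) + 1) * l / 12 * ((N : ℝ) * Real.log p)) := by
  rw [(ThetaVolumeInput.deepAt p l hl h5 N hN σ).negLogThetaLoc_of_prime hp.out]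
  have h := realPrimePacketWith_negLogThetaAt_eq_of_scalar_of_finrank_eq_one p
    ((ThetaVolumeInput.deepAt p l hl h5 N hN σ).σ.localFieldFamily p hp.out)
    (mScale p ((ThetaVolumeInput.deepAt p l hl h5 N hN σ).σ.localFieldFamily p hp.out))
    (mScale_ne_zero p ((ThetaVolumeInput.deepAt p l hl h5 N hN σ).σ.localFieldFamily p hp.out))
    (mScale_perm p ((ThetaVolumeInput.deepAt p l hl h5 N hN σ).σ.localFieldFamily p hp.out))
    (fun v => finrank_localFields_rat_eq_one σ p v)
    ((ThetaVolumeInput.deepAt p l hl h5 N hN σ).tΘ p hp.out) (fun i => ((i : ℕ) + 1) ^ 2 * N)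
    (fun i v => coe_tΘ_deepAt p l hl h5 σ N hN i v)
  refine h.trans ?_
  change (1 / (((l - 1) / 2 : ℕ) : ℝ)) * ∑ i : Fin ((l - 1) / 2), -((((((i : ℕ) + 1) ^ 2 * N : ℕ) : ℕ) : ℝ) * Real.log p) = _
  have hfac : ∑ i : Fin ((l - 1) / 2), -((((((i : ℕ) + 1) ^ 2 * N : ℕ) : ℕ) : ℝ) * Real.log p) =
      -(((N : ℝ) * Real.log p) * ∑ i : Fin ((l - 1) / 2), (((i : ℕ) : ℝ) + 1) ^ 2) := by
    rw [Finset.mul_sum, ← Finset.sum_neg_distrib]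
    exact Finset.sum_congr rfl fun i _ => by push_cast; ring
  rw [hfac, mul_neg, mul_left_comm, avg_sum_sq_eq l hl h5]
  ring

/-- **Over `ℚ/ℚ` every OTHER prime contributes `0`** to the family's `−|log(Θ)|`: there the synthetic Θ-idele is `1 = p'^0`, the region is
`(R_{v⃗})^∼`, its possible images and their hull are `(R_{v⃗})^∼`, of log-volume `0` ([IUTchIV] Step (vi) in the rank-one form).
[cite: Mochizuki2012, IUTchIV Thm. 1.10 Step (vi) p. 29] [cite: DupuyHilado2025, Def. 3.6.3] [claim: Mochizuki2012, status: disputed] -/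
theorem negLogThetaLoc_deepAt_rat_of_ne (N : ℕ) (hN : 0 < N) {p' : ℕ} (hp' : p' ≠ p) :
    (ThetaVolumeInput.deepAt p l hl h5 N hN σ).negLogThetaLoc p' = 0 := by
  by_cases hpr : p'.Prime
  · haveI : Fact p'.Prime := ⟨hpr⟩
    rw [(ThetaVolumeInput.deepAt p l hl h5 N hN σ).negLogThetaLoc_of_prime hpr]
    have ht : ∀ (i : Fin (ThetaVolumeInput.deepAt p l hl h5 N hN σ).lstar) (v : placesOver ℚ p'),
        (((ThetaVolumeInput.deepAt p l hl h5 N hN σ).tΘ p' hpr i v :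
            ((ThetaVolumeInput.deepAt p l hl h5 N hN σ).σ.localFieldFamily p' hpr).k v) : _) =
          algebraMap ℚ_[p'] (((ThetaVolumeInput.deepAt p l hl h5 N hN σ).σ.localFieldFamily p' hpr).k v)
            ((p' : ℚ_[p']) ^ (0 : ℕ)) := by
      intro i v
      have hv : v.1 ∉ placesOver ℚ p := fun h => hp'
        (((mem_placesOver_iff_residueChar v.1).mp v.2).symm.trans ((mem_placesOver_iff_residueChar v.1).mp h))
      rw [pow_zero, map_one]
      simp only [ThetaVolumeInput.deepAt, if_neg hv, pow_zero, Units.val_one]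
      rfl
    have h := realPrimePacketWith_negLogThetaAt_eq_of_scalar_of_finrank_eq_one p'
      ((ThetaVolumeInput.deepAt p l hl h5 N hN σ).σ.localFieldFamily p' hpr)
      (mScale p' ((ThetaVolumeInput.deepAt p l hl h5 N hN σ).σ.localFieldFamily p' hpr))
      (mScale_ne_zero p' ((ThetaVolumeInput.deepAt p l hl h5 N hN σ).σ.localFieldFamily p' hpr))
      (mScale_perm p' ((ThetaVolumeInput.deepAt p l hl h5 N hN σ).σ.localFieldFamily p' hpr))
      (fun v => finrank_localFields_rat_eq_one σ p' v)
      ((ThetaVolumeInput.deepAt p l hl h5 N hN σ).tΘ p' hpr) (fun _ => 0) ht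
    refine h.trans ?_
    simp
  · rw [ThetaVolumeInput.negLogThetaLoc, dif_neg hpr]

/-- **`−|log(Θ)|^nonarch` of the family over `ℚ/ℚ`, closed form at EVERY prime `p`**: `negLogThetaNonarch (deepAt p l N σ) = −((l+1)l/12)·N·log p`
— no inflation anywhere, no intercept. [cite: DupuyHilado2025, §1 (1.1), Def. 3.6.3] [claim: Mochizuki2012, status: disputed] -/
theorem negLogThetaNonarch_deepAt_rat (N : ℕ) (hN : 0 < N) :
    (ThetaVolumeInput.deepAt p l hl h5 N hN σ).negLogThetaNonarch = -(((l : ℝ) + 1) * l / 12 * ((N : ℝ) * Real.log p)) := by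
  classical
  unfold ThetaVolumeInput.negLogThetaNonarch
  rw [← Finset.add_sum_erase _ _ (mem_supportPrimes_deepAt p l hl h5 σ N hN),
    negLogThetaLoc_deepAt_rat_self p l hl h5 σ N hN,
    Finset.sum_eq_zero fun p' hp' => negLogThetaLoc_deepAt_rat_of_ne p l hl h5 σ N hN (Finset.ne_of_mem_erase hp'),
    add_zero]

/-- **`−|log(Θ)|` of the family over `ℚ/ℚ`**: `negLogTheta (deepAt p l N σ) = −((l+1)l/12)·N·log p + ((l+5)/4)·log π`.
[cite: Mochizuki2012, IUTchIV Thm. 1.10 Step (vii) p. 30] [claim: Mochizuki2012, status: disputed] -/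
theorem negLogTheta_deepAt_rat (N : ℕ) (hN : 0 < N) :
    (ThetaVolumeInput.deepAt p l hl h5 N hN σ).negLogTheta =
      -(((l : ℝ) + 1) * l / 12 * ((N : ℝ) * Real.log p)) + ThetaVolumeInput.archLogTheta l := by
  unfold ThetaVolumeInput.negLogTheta
  rw [negLogThetaNonarch_deepAt_rat p l hl h5 σ N hN]
  rfl

/-- **THE THRESHOLD OVER `ℚ/ℚ`, FULLY NUMERIC**: for every section `σ`, prime `p` (any), prime `l ≥ 5` and depth `N ≥ 1`,
`Cor312Of (deepAt p l N σ) ↔ ((l+1)l/12 − 1)·N·log p ≤ ((l+5)/4)·log π` — the free gap against the archimedean term alone.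
HYPOTHESIS-shaped on the left; synthetic input; no side taken. [cite: Mochizuki2012, IUTchIII Cor. 3.12 p. 173–174]
[cite: Mochizuki2012, IUTchIV Thm. 1.10 Step (vi)–(vii) p. 29–30] [claim: Mochizuki2012, status: disputed] -/
theorem cor312Of_deepAt_rat_iff (N : ℕ) (hN : 0 < N) :
    (ThetaVolumeInput.deepAt p l hl h5 N hN σ).Cor312Of ↔
      (((l : ℝ) + 1) * l / 12 - 1) * ((N : ℝ) * Real.log p) ≤ ThetaVolumeInput.archLogTheta l := by
  unfold ThetaVolumeInput.Cor312Of
  rw [ThetaVolumeInput.deepAt_negAbsLogQ' p l hl h5 N hN σ, negLogTheta_deepAt_rat p l hl h5 σ N hN]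
  constructor <;> intro h <;> linarith

/-- The same threshold in reading (P) (XXVIId-e: the readings coincide on the slot-constant family).
[cite: Mochizuki2012, IUTchIII Cor. 3.12 p. 173–174] [claim: Mochizuki2012, status: disputed] -/
theorem cor312PerImageOf_deepAt_rat_iff (N : ℕ) (hN : 0 < N) :
    (ThetaVolumeInput.deepAt p l hl h5 N hN σ).Cor312PerImageOf ↔
      (((l : ℝ) + 1) * l / 12 - 1) * ((N : ℝ) * Real.log p) ≤ ThetaVolumeInput.archLogTheta l := by
  rw [cor312PerImageOf_deepAt_iff_cor312Of, cor312Of_deepAt_rat_iff]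

end OverQ

end Summit.ABC.IUTFork.GenuineContent

end
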